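import Literature.NumberTheory.LFunctions.Zhang2022.RepairBlenLambdaWhole
import Literature.NumberTheory.LFunctions.Zhang2022.RepairGramBlock

/-!
# Zhang (2022) repair bed — W1 satisfiability witnesses IV: NAMED worlds for the Λ-block slots
# (`LambdaDiagNonneg`, `LambdaBlockCS`, `LambdaOverhangCS`, `LambdaWholeCS`, `LambdaOverhang/WholeIndefinite`)
# and a plain member of `JumpKernelPos`

Cell `landau-siegel` (rung F-S3), D-0124 LS RESCUE, seat ls-rescue-typ-2 g3 (typer: bed objects + W1 witnesses).
Y. Zhang, *Discrete mean estimates and the Landau–Siegel zero*, arXiv:2211.02515v1 (2022) [Zhang2022LandauSiegel] —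
**an unrefereed manuscript under adjudication. WHAT THIS IS NOT: no claim about its Theorems 1–2, about Landau–Siegel
zeros, about Parity, or about a repaired `Margin232`; no slot of the registry (E-030, E-070/071) is asserted for the
(A)-world; every object below is a MODEL WORLD `(K, X)` for the PARAMETERS of those rows (pure data), and every theorem
is either 2×2 Cauchy–Schwarz arithmetic about that data or an existing verdict theorem applied to it.** «refuted-as-typed ≠
refuted-in-print»; «the summit (Siegel-zero exclusion) is the target, not the manuscript».

## Why (W1 census, ls-rescue-ref-1 SAT-CENSUS v2.1b, 2026-08-27T14:27Z)

The kernel census labels a hypothesis-carrying theorem W(a) when every hypothesis HEAD has a NAMED, non-degenerate,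
unconditional inhabitant in the tree. Ten theorems of `RepairLambdaBlock` / `RepairBlenLambda` / `RepairBlenLambdaWhole` /
`RepairGramBlock` stayed UNWITNESSED on the heads `KnifeEdge.LambdaBlockCS`, `LambdaOverhangCS`, `LambdaWholeCS`,
`LambdaDiagNonneg`, `Repair.LambdaOverhangIndefinite` (+ `LambdaWholeIndefinite`), and one of `RepairJumpBlock` on
`KnifeEdge.JumpKernelPos`. The tree already inhabits the CS heads — but only inside conjunctions / existentials that a
head-symbol census cannot see: `Repair.saturatingWorld_slots` (K ≡ 1, κ_× = √𝔅(u): CS with EQUALITY),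
`saturatingWorld_overhang_slots`, `saturatingWorld_whole_slots`, and the `∃ K X` worlds of `lambdaCross_slot_loadBearing` /
`lambdaOverhangCross_slot_loadBearing` (indefinite). This file NAMES members by head, and adds one non-constant world of
the claimed kind.

## What is here (kernel)

* Part 1 — the CS-saturating world of record, one theorem per head (`lambdaDiagNonneg_saturating`,
  `lambdaBlockCS_saturating`, `lambdaOverhangCS_saturating`, `lambdaWholeCS_saturating`, and the two sign slots).
* Part 2 — **the geometric-mean cross at coupling ratio `t`**: `gmCross t K u u' L := t·√𝔅(u)·√K(L)` (ls-theory's Q1(ii)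
  reading «κ_× of geometric-mean, i.e. Cauchy–Schwarz-saturating, order»; the derivation of rows E-030/E-070/E-071 is what
  would fix `t` — NOT done anywhere). For ANY diagonal `K ≥ 0` on a class: CS-subordinate on that class iff-direction
  `|t| ≤ 1` (`lambdaBlockCS_gmCross`, `lambdaOverhangCS_gmCross`, `lambdaWholeCS_gmCross`); INDEFINITE on any member with
  `𝔅(u) > 0`, `K(L) > 0` once `1 < |t|` (`lambdaBlockIndefinite_gmCross`, `lambdaOverhangIndefinite_gmCross`,
  `lambdaWholeIndefinite_gmCross`).
* Part 3 — named NON-CONSTANT worlds: the E-cell's plain-PNT diagonals of record `KnifeEdge.lambdaOverhangDiag θ (fun z => z)`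
  (`∫₁^θ z‖prof‖²`, p461166) and `KnifeEdge.lambdaWholeDiag θ (fun z => z)` (`∫₀^θ z‖prof‖²`) with the gm-cross: CS members
  at every `|t| ≤ 1` (closed instances at `t = 1/2`), and — via `0 < ∫₁^θ z·P₁(z)² ` for the MV taper
  (`lambdaOverhangDiag_id_mvTaperPiece_pos`) and `𝔅(ϰ_{1,5/2}) > 0` (`KnifeEdge.mainTermForm_kappaP_one_pos`) — INDEFINITE
  members at every `1 < |t|` (closed instances at `t = 2`, `θ = 5/4`). **Knife-edge sentences** (kernel):
  `eLambdaOverhangCloses_plain_gmCross_iff` / `eLambdaWholeCloses_plain_gmCross_iff` / `eMultiLambdaCloses_sat_gmCross_iff` —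
  in these worlds the class CLOSES iff `1 < |t|`: the verdict theorems of the three files flip exactly at the CS ratio.
* Part 4 — instance level: the UNW verdict theorems applied in the named worlds to members of record
  (`posSemidef_lambdaGram_plain_half_feng1`, `lambdaDiagNonneg_of_cs_plain_half`, …).
* Part 5 — `JumpKernelPos`: the plain member `κ(z) = z` (the `L²`-mass of the step `𝟙_[0,z)`, same status as the weight
  `w(z) = z` of `lambdaOverhangDiag`; the DERIVED kernel of row multi-E1 stays ls-theory's item) and `κ(z) = z(1−z)`;
  the M1 verdict `familyJumpBlock_verdict_of_jumpKernelPos` applied to `jumpOne` / `jumpStar` in that world.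

Nothing here is numerics; no kit job. MODEL worlds; never «X exists»; no (A)-guarded node verified/violated.

## References
* Y. Zhang, arXiv:2211.02515v1 (2022), §2 (2.15)–(2.20), Lemma 2.3; §7 Prop 7.1, (7.2) p. 44; §10 Lemma 10.1 (10.5).
  [cite: Zhang2022LandauSiegel, §7 Prop 7.1 (7.2)]
* R. A. Horn, C. R. Johnson, *Matrix Analysis*, 2nd ed., CUP 2013, Thm 7.2.5 (2×2 PSD criterion). [cite: HornJohnson2013, Thm 7.2.5]
«The programme SEARCHES and TYPES; no claim about Landau–Siegel zeros, Theorems 1–2 of arXiv:2211.02515 or a repaired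
Margin232 until a kernel theorem says so.»
-/

noncomputable section

open Complex Real Set
open _root_.MeasureTheory
open scoped ComplexOrder

namespace Literature.NumberTheory.LFunctions.Zhang2022

namespace Repair

open KnifeEdge Skeleton

/-! ### Part 1 — the CS-saturating world of record (`K ≡ 1`, `κ_× = √𝔅(u)`), one theorem per head -/

/-- `K ≡ 1` satisfies the E-030 sign slot `LambdaDiagNonneg` (head form of `saturatingWorld_slots`).
[cite: Zhang2022LandauSiegel, §7 Prop 7.1 (7.2)] -/
theorem lambdaDiagNonneg_saturating : LambdaDiagNonneg saturatingDiag := saturatingWorld_slots.1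

/-- The saturating world satisfies the E-030 CS slot `LambdaBlockCS`, with equality (head form of `saturatingWorld_slots`).
[cite: Zhang2022LandauSiegel, §2 Lemma 2.3, (2.15)] -/
theorem lambdaBlockCS_saturating : LambdaBlockCS saturatingDiag saturatingCross := saturatingWorld_slots.2.1

/-- `K ≡ 1` satisfies the E-070 sign slot on the overhang class at every top `θ`.
[cite: Zhang2022LandauSiegel, §7 Prop 7.1 (7.2)] -/
theorem lambdaOverhangDiagNonneg_saturating (θ : ℝ) : LambdaOverhangDiagNonneg θ saturatingDiag :=
  (saturatingWorld_overhang_slots θ).1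

/-- The saturating world satisfies the E-071 CS slot `LambdaOverhangCS θ` at every top `θ` (head form of
`saturatingWorld_overhang_slots`). [cite: Zhang2022LandauSiegel, §2 Lemma 2.3, (2.15)] -/
theorem lambdaOverhangCS_saturating (θ : ℝ) : LambdaOverhangCS θ saturatingDiag saturatingCross :=
  (saturatingWorld_overhang_slots θ).2.1

/-- `K ≡ 1` satisfies the whole-range sign slot at every top `θ`. [cite: Zhang2022LandauSiegel, §7 Prop 7.1 (7.2)] -/
theorem lambdaWholeDiagNonneg_saturating (θ : ℝ) : LambdaWholeDiagNonneg θ saturatingDiag :=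
  (saturatingWorld_whole_slots θ).1

/-- The saturating world satisfies the whole-range CS slot `LambdaWholeCS θ` (head form of `saturatingWorld_whole_slots`).
[cite: Zhang2022LandauSiegel, §2 Lemma 2.3, (2.15)] -/
theorem lambdaWholeCS_saturating (θ : ℝ) : LambdaWholeCS θ saturatingDiag saturatingCross :=
  (saturatingWorld_whole_slots θ).2.1

/-! ### Part 2 — the geometric-mean cross at coupling ratio `t` -/

/-- **The geometric-mean cross at coupling ratio `t` over a diagonal `K`:** `κ_×(u,L) = t·√𝔅(u)·√K(L)` — the model of
ls-theory's reading Q1(ii) «the `u×λ` coupling is of geometric-mean (Cauchy–Schwarz-saturating) order»; the ratio `t`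
is what the underived dictionary of rows E-030 / E-070 / E-071 would fix. Pure data, asserted to be nothing.
[cite: Zhang2022LandauSiegel, §7 Prop 7.1 (7.2)] -/
def gmCross (t : ℝ) (K : LambdaDiag) : LambdaCross := fun u u' L =>
  ((t * Real.sqrt (mainTermForm u u') * Real.sqrt (K L) : ℝ) : ℂ)

/-- `|κ_×|² = t²·𝔅(u)·K(L)` wherever `𝔅(u) ≥ 0` and `K(L) ≥ 0`. [cite: Zhang2022LandauSiegel, §7 Prop 7.1 (7.2)] -/
theorem norm_gmCross_sq {t : ℝ} {K : LambdaDiag} {u u' : ℝ → ℂ} {L : LambdaPiece}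
    (hB : 0 ≤ mainTermForm u u') (hK : 0 ≤ K L) :
    ‖gmCross t K u u' L‖ ^ 2 = t ^ 2 * (mainTermForm u u' * K L) := by
  unfold gmCross
  rw [Complex.norm_real, Real.norm_eq_abs, sq_abs, mul_pow, mul_pow, Real.sq_sqrt hB, Real.sq_sqrt hK]
  ring

/-- CS arithmetic: for `|t| ≤ 1` the gm-cross is subordinate, `|κ_×|² ≤ 𝔅(u)·K(L)`. [cite: HornJohnson2013, Thm 7.2.5] -/
theorem norm_gmCross_sq_le {t : ℝ} (ht : |t| ≤ 1) {K : LambdaDiag} {u u' : ℝ → ℂ} {L : LambdaPiece}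
    (hB : 0 ≤ mainTermForm u u') (hK : 0 ≤ K L) :
    ‖gmCross t K u u' L‖ ^ 2 ≤ mainTermForm u u' * K L := by
  rw [norm_gmCross_sq hB hK]
  have ht2 : t ^ 2 ≤ 1 := by
    rw [← sq_abs]
    exact pow_le_one₀ (abs_nonneg t) ht
  have hBK : 0 ≤ mainTermForm u u' * K L := mul_nonneg hB hK
  nlinarith

/-- CS arithmetic: for `1 < |t|` the gm-cross makes the block INDEFINITE on any member with `𝔅(u) > 0`, `K(L) > 0`.
[cite: HornJohnson2013, Thm 7.2.5] -/
theorem lt_norm_gmCross_sq {t : ℝ} (ht : 1 < |t|) {K : LambdaDiag} {u u' : ℝ → ℂ} {L : LambdaPiece}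
    (hB : 0 < mainTermForm u u') (hK : 0 < K L) :
    mainTermForm u u' * K L < ‖gmCross t K u u' L‖ ^ 2 := by
  rw [norm_gmCross_sq hB.le hK.le]
  have ht2 : 1 < t ^ 2 := by
    rw [← sq_abs]
    nlinarith [abs_nonneg t]
  have hBK : 0 < mainTermForm u u' * K L := mul_pos hB hK
  nlinarith

/-- **E-030 CS slot in the gm-world:** for any `K ≥ 0` on admissible pieces and any ratio `|t| ≤ 1`,
`LambdaBlockCS K (gmCross t K)` (`𝔅(u) ≥ 0` on kinked profiles: `mainTermForm_nonneg_of_isH1`).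
[cite: Zhang2022LandauSiegel, §2 Lemma 2.3, (2.15)] -/
theorem lambdaBlockCS_gmCross {K : LambdaDiag} (hK : LambdaDiagNonneg K) {t : ℝ} (ht : |t| ≤ 1) :
    LambdaBlockCS K (gmCross t K) := fun _ _ L hu _ hL =>
  norm_gmCross_sq_le ht (mainTermForm_nonneg_of_isH1 hu.isH1) (hK L hL)

/-- **E-071 CS slot in the gm-world** (overhang class at top `θ`), any `K ≥ 0` on the class, any `|t| ≤ 1`.
[cite: Zhang2022LandauSiegel, §2 Lemma 2.3, (2.15)] -/
theorem lambdaOverhangCS_gmCross {θ : ℝ} {K : LambdaDiag} (hK : LambdaOverhangDiagNonneg θ K) {t : ℝ}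
    (ht : |t| ≤ 1) : LambdaOverhangCS θ K (gmCross t K) := fun _ _ L v' hu _ hL =>
  norm_gmCross_sq_le ht (mainTermForm_nonneg_of_isH1 hu.isH1) (hK L v' hL)

/-- **Whole-range CS slot in the gm-world**, any `K ≥ 0` on the class, any `|t| ≤ 1`.
[cite: Zhang2022LandauSiegel, §2 Lemma 2.3, (2.15)] -/
theorem lambdaWholeCS_gmCross {θ : ℝ} {K : LambdaDiag} (hK : LambdaWholeDiagNonneg θ K) {t : ℝ} (ht : |t| ≤ 1) :
    LambdaWholeCS θ K (gmCross t K) := fun _ _ L v' hu _ hL =>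
  norm_gmCross_sq_le ht (mainTermForm_nonneg_of_isH1 hu.isH1) (hK L v' hL)

/-- **E-030 edge report in the gm-world:** a member with `𝔅(u) > 0`, `K(L) > 0` makes `LambdaBlockIndefinite K (gmCross t K)`
for every `1 < |t|`. [cite: Zhang2022LandauSiegel, §7 Prop 7.1 (7.2)] -/
theorem lambdaBlockIndefinite_gmCross {K : LambdaDiag} {t : ℝ} (ht : 1 < |t|) {u u' : ℝ → ℂ} {L : LambdaPiece}
    (hu : KinkedProfile u u') (hu1 : u 1 = 0) (hL : L.Admissible) (hB : 0 < mainTermForm u u') (hK : 0 < K L) :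
    LambdaBlockIndefinite K (gmCross t K) :=
  ⟨u, u', L, hu, hu1, hL, lt_norm_gmCross_sq ht hB hK⟩

/-- **E-070/071 edge report in the gm-world** (overhang class). [cite: Zhang2022LandauSiegel, §7 Prop 7.1 (7.2)] -/
theorem lambdaOverhangIndefinite_gmCross {θ : ℝ} {K : LambdaDiag} {t : ℝ} (ht : 1 < |t|) {u u' : ℝ → ℂ}
    {L : LambdaPiece} {v' : ℝ → ℂ} (hu : KinkedProfile u u') (hu1 : u 1 = 0) (hL : L.Overhang θ v')
    (hB : 0 < mainTermForm u u') (hK : 0 < K L) : LambdaOverhangIndefinite θ K (gmCross t K) :=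
  ⟨u, u', L, v', hu, hu1, hL, lt_norm_gmCross_sq ht hB hK⟩

/-- **Whole-range edge report in the gm-world.** [cite: Zhang2022LandauSiegel, §7 Prop 7.1 (7.2)] -/
theorem lambdaWholeIndefinite_gmCross {θ : ℝ} {K : LambdaDiag} {t : ℝ} (ht : 1 < |t|) {u u' : ℝ → ℂ}
    {L : LambdaPiece} {v' : ℝ → ℂ} (hu : KinkedProfile u u') (hu1 : u 1 = 0) (hL : L.Whole θ v')
    (hB : 0 < mainTermForm u u') (hK : 0 < K L) : LambdaWholeIndefinite θ K (gmCross t K) :=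
  ⟨u, u', L, v', hu, hu1, hL, lt_norm_gmCross_sq ht hB hK⟩

/-! ### Part 3 — named non-constant worlds: the plain-PNT diagonals of record with the gm-cross -/

/-- **E-030 sign slot for the plain diagonal `∫₀¹ z‖prof‖²`** (`KnifeEdge.lambdaWholeDiag 1 (fun z => z)`; non-negative
on EVERY piece). [cite: Zhang2022LandauSiegel, §7 Prop 7.1 (7.2)] -/
theorem lambdaDiagNonneg_plain : LambdaDiagNonneg (lambdaWholeDiag 1 fun z => z) :=
  fun L _ => lambdaWholeDiag_nonneg zero_le_one (fun _ hz => hz.1) L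

/-- The overhang plain-PNT diagonal `∫₁^θ z‖prof‖²` is `≥ 0` on the WHOLE-range class too (`θ > 1` is inside `Whole`).
[cite: Zhang2022LandauSiegel, §7 Prop 7.1 (7.2) p.44] -/
theorem lambdaWholeDiagNonneg_overhangPlain (θ : ℝ) : LambdaWholeDiagNonneg θ (lambdaOverhangDiag θ fun z => z) :=
  fun L _ hL => lambdaOverhangDiag_nonneg hL.one_lt.le (fun _ hz => zero_le_one.trans hz.1) L

/-- **E-030 CS slot, plain diagonal, any ratio `|t| ≤ 1`.** [cite: Zhang2022LandauSiegel, §2 Lemma 2.3, (2.15)] -/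
theorem lambdaBlockCS_plain_gmCross {t : ℝ} (ht : |t| ≤ 1) :
    LambdaBlockCS (lambdaWholeDiag 1 fun z => z) (gmCross t (lambdaWholeDiag 1 fun z => z)) :=
  lambdaBlockCS_gmCross lambdaDiagNonneg_plain ht

/-- **E-071 CS slot, plain-PNT overhang diagonal `∫₁^θ z‖prof‖²` (p461166's `lambdaOverhangDiag θ id`), any `|t| ≤ 1`.**
[cite: Zhang2022LandauSiegel, §2 Lemma 2.3, (2.15)] -/
theorem lambdaOverhangCS_plain_gmCross (θ : ℝ) {t : ℝ} (ht : |t| ≤ 1) :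
    LambdaOverhangCS θ (lambdaOverhangDiag θ fun z => z) (gmCross t (lambdaOverhangDiag θ fun z => z)) :=
  lambdaOverhangCS_gmCross lambdaOverhangDiagNonneg_id ht

/-- **Whole-range CS slot, plain-PNT whole diagonal `∫₀^θ z‖prof‖²`, any `|t| ≤ 1`.**
[cite: Zhang2022LandauSiegel, §2 Lemma 2.3, (2.15)] -/
theorem lambdaWholeCS_plain_gmCross (θ : ℝ) {t : ℝ} (ht : |t| ≤ 1) :
    LambdaWholeCS θ (lambdaWholeDiag θ fun z => z) (gmCross t (lambdaWholeDiag θ fun z => z)) :=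
  lambdaWholeCS_gmCross lambdaWholeDiagNonneg_id ht

/-- Whole-range CS slot for the overhang plain diagonal, any `|t| ≤ 1`. [cite: Zhang2022LandauSiegel, §2 Lemma 2.3, (2.15)] -/
theorem lambdaWholeCS_overhangPlain_gmCross (θ : ℝ) {t : ℝ} (ht : |t| ≤ 1) :
    LambdaWholeCS θ (lambdaOverhangDiag θ fun z => z) (gmCross t (lambdaOverhangDiag θ fun z => z)) :=
  lambdaWholeCS_gmCross (lambdaWholeDiagNonneg_overhangPlain θ) ht

/-- `|1/2| ≤ 1`. [folklore] -/
private theorem abs_half_le_one : |(1 / 2 : ℝ)| ≤ 1 := by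
  rw [abs_of_pos (by norm_num)]; norm_num

/-- `1 < |2|`. [folklore] -/
private theorem one_lt_abs_two : (1 : ℝ) < |2| := by
  rw [abs_of_pos (by norm_num)]; norm_num

/-- **Closed member (block class):** plain diagonal, gm-cross at ratio `1/2` — STRICTLY inside CS, `K` non-constant.
[cite: Zhang2022LandauSiegel, §2 Lemma 2.3, (2.15)] -/
theorem lambdaBlockCS_plain_half :
    LambdaBlockCS (lambdaWholeDiag 1 fun z => z) (gmCross (1 / 2) (lambdaWholeDiag 1 fun z => z)) :=
  lambdaBlockCS_plain_gmCross abs_half_le_one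

/-- **Closed member (overhang class, every `θ`):** plain-PNT diagonal, gm-cross at ratio `1/2`.
[cite: Zhang2022LandauSiegel, §2 Lemma 2.3, (2.15)] -/
theorem lambdaOverhangCS_plain_half (θ : ℝ) :
    LambdaOverhangCS θ (lambdaOverhangDiag θ fun z => z) (gmCross (1 / 2) (lambdaOverhangDiag θ fun z => z)) :=
  lambdaOverhangCS_plain_gmCross θ abs_half_le_one

/-- **Closed member (whole-range class, every `θ`):** plain-PNT whole diagonal, gm-cross at ratio `1/2`.
[cite: Zhang2022LandauSiegel, §2 Lemma 2.3, (2.15)] -/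
theorem lambdaWholeCS_plain_half (θ : ℝ) :
    LambdaWholeCS θ (lambdaWholeDiag θ fun z => z) (gmCross (1 / 2) (lambdaWholeDiag θ fun z => z)) :=
  lambdaWholeCS_plain_gmCross θ abs_half_le_one

/-- **The plain-PNT diagonal is POSITIVE on the MV taper** `P₁(z) = (θ−z)/(θ−1)` on `[1,θ]`:
`∫₁^θ z·P₁(z)² dz > 0` for `θ > 1` (integrand continuous and `> 0` on `(1,θ)`). [cite: Zhang2022LandauSiegel, §7 (7.2) p.44] -/
theorem lambdaOverhangDiag_id_mvTaperPiece_pos {θ : ℝ} (hθ : 1 < θ) :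
    0 < lambdaOverhangDiag θ (fun z => z) (mvTaperPiece θ) := by
  rw [lambdaOverhangDiag_apply]
  change 0 < ∫ z in (1:ℝ)..θ, z * ‖mvTaper θ z‖ ^ 2
  have hcongr : EqOn (fun z : ℝ => z * ‖mvTaper θ z‖ ^ 2) (fun z => z * ((θ - z) / (θ - 1)) ^ 2) (Icc 1 θ) := by
    intro z hz
    have h1 : ¬ z < 1 := not_lt.2 hz.1
    have hnn : 0 ≤ (θ - z) / (θ - 1) := div_nonneg (by linarith [hz.2]) (by linarith)
    simp only [mvTaper, if_neg h1, max_eq_left hnn, Complex.norm_real, Real.norm_eq_abs, abs_of_nonneg hnn]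
  have hcont : ContinuousOn (fun z : ℝ => z * ((θ - z) / (θ - 1)) ^ 2) (Icc 1 θ) := by fun_prop
  refine intervalIntegral.intervalIntegral_pos_of_pos_on ((hcont.congr hcongr).intervalIntegrable_of_Icc hθ.le) ?_ hθ
  intro z hz
  have hz' := hcongr ⟨hz.1.le, hz.2.le⟩
  dsimp only at hz'
  rw [hz']
  have hq : 0 < (θ - z) / (θ - 1) := div_pos (by linarith [hz.2]) (by linarith)
  have hz0 : 0 < z := by linarith [hz.1]
  positivity

/-- **Edge-report member (overhang class):** `u = ϰ_{1,5/2}` (`𝔅 > 0`, `KnifeEdge.mainTermForm_kappaP_one_pos`), `L` = the MV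
taper piece of top `θ`, plain-PNT diagonal, gm-cross at any ratio `1 < |t|` ⇒ `LambdaOverhangIndefinite`.
[cite: Zhang2022LandauSiegel, §7 Prop 7.1 (7.2)] -/
theorem lambdaOverhangIndefinite_plain_gmCross {θ t : ℝ} (hθ : 1 < θ) (ht : 1 < |t|) :
    LambdaOverhangIndefinite θ (lambdaOverhangDiag θ fun z => z) (gmCross t (lambdaOverhangDiag θ fun z => z)) :=
  lambdaOverhangIndefinite_gmCross ht (kinkedProfile_kappaP (k := 5 / 2) one_pos le_rfl)
    (kappaP_one one_pos le_rfl) (overhang_mvTaperPiece hθ) mainTermForm_kappaP_one_pos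
    (lambdaOverhangDiag_id_mvTaperPiece_pos hθ)

/-- **Edge-report member (whole-range class)** — the same member read in the whole-range class (`Overhang ⊆ Whole`).
[cite: Zhang2022LandauSiegel, §7 Prop 7.1 (7.2)] -/
theorem lambdaWholeIndefinite_plain_gmCross {θ t : ℝ} (hθ : 1 < θ) (ht : 1 < |t|) :
    LambdaWholeIndefinite θ (lambdaOverhangDiag θ fun z => z) (gmCross t (lambdaOverhangDiag θ fun z => z)) :=
  (lambdaOverhangIndefinite_plain_gmCross hθ ht).whole

/-- **Edge-report member (in-length class E-030):** `u = ϰ_{1,5/2}`, `L` = Feng's piece `lambdaPieceFeng1`, `K ≡ 1`, gm-cross at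
any `1 < |t|` (i.e. `t·√𝔅(u)`, the saturating cross scaled past the edge) ⇒ `LambdaBlockIndefinite`.
[cite: Zhang2022LandauSiegel, §7 Prop 7.1 (7.2)] -/
theorem lambdaBlockIndefinite_sat_gmCross {t : ℝ} (ht : 1 < |t|) :
    LambdaBlockIndefinite saturatingDiag (gmCross t saturatingDiag) :=
  lambdaBlockIndefinite_gmCross ht (kinkedProfile_kappaP (k := 5 / 2) one_pos le_rfl) (kappaP_one one_pos le_rfl)
    admissible_lambdaPieceFeng1 mainTermForm_kappaP_one_pos (by simp [saturatingDiag])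

/-- **Closed edge-report instance (overhang, top `5/4` = B-len's `th5:4`, ratio `2`).** [cite: Zhang2022LandauSiegel, §7 Prop 7.1 (7.2)] -/
theorem lambdaOverhangIndefinite_plain_two :
    LambdaOverhangIndefinite (5 / 4) (lambdaOverhangDiag (5 / 4) fun z => z)
      (gmCross 2 (lambdaOverhangDiag (5 / 4) fun z => z)) :=
  lambdaOverhangIndefinite_plain_gmCross (by norm_num) one_lt_abs_two

/-- **Closed edge-report instance (whole-range, top `5/4`, ratio `2`).** [cite: Zhang2022LandauSiegel, §7 Prop 7.1 (7.2)] -/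
theorem lambdaWholeIndefinite_plain_two :
    LambdaWholeIndefinite (5 / 4) (lambdaOverhangDiag (5 / 4) fun z => z)
      (gmCross 2 (lambdaOverhangDiag (5 / 4) fun z => z)) :=
  lambdaWholeIndefinite_plain_gmCross (by norm_num) one_lt_abs_two

/-- **Closed edge-report instance (in-length, `K ≡ 1`, ratio `2`).** [cite: Zhang2022LandauSiegel, §7 Prop 7.1 (7.2)] -/
theorem lambdaBlockIndefinite_sat_two : LambdaBlockIndefinite saturatingDiag (gmCross 2 saturatingDiag) :=
  lambdaBlockIndefinite_sat_gmCross one_lt_abs_two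

/-! ### Part 3b — knife-edge sentences: in these worlds the class closes iff the coupling ratio exceeds `1` -/

/-- **Λ-overhang class (rows E-070/071), plain-PNT diagonal, gm-cross:** for `θ > 1` the model CLOSES iff `1 < |t|`
(`←`: the edge-report member; `→`: CS at `|t| ≤ 1` and `not_eLambdaOverhangCloses_of_cs`).
[cite: Zhang2022LandauSiegel, §7 Prop 7.1 (7.2)] -/
theorem eLambdaOverhangCloses_plain_gmCross_iff {θ : ℝ} (hθ : 1 < θ) (t : ℝ) :
    ELambdaOverhangCloses θ (lambdaOverhangDiag θ fun z => z) (gmCross t (lambdaOverhangDiag θ fun z => z)) ↔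
      1 < |t| := by
  constructor
  · intro h
    by_contra hle
    exact not_eLambdaOverhangCloses_of_cs lambdaOverhangDiagNonneg_id
      (lambdaOverhangCS_plain_gmCross θ (not_lt.1 hle)) h
  · intro ht
    exact eLambdaOverhangCloses_iff_indefinite.2 (lambdaOverhangIndefinite_plain_gmCross hθ ht)

/-- **Whole-range class, overhang plain diagonal, gm-cross:** for `θ > 1` the model CLOSES iff `1 < |t|`.
[cite: Zhang2022LandauSiegel, §7 Prop 7.1 (7.2)] -/
theorem eLambdaWholeCloses_plain_gmCross_iff {θ : ℝ} (hθ : 1 < θ) (t : ℝ) :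
    ELambdaWholeCloses θ (lambdaOverhangDiag θ fun z => z) (gmCross t (lambdaOverhangDiag θ fun z => z)) ↔
      1 < |t| := by
  constructor
  · intro h
    by_contra hle
    exact not_eLambdaWholeCloses_of_cs (lambdaWholeDiagNonneg_overhangPlain θ)
      (lambdaWholeCS_overhangPlain_gmCross θ (not_lt.1 hle)) h
  · intro ht
    exact eLambdaWholeCloses_iff_indefinite.2 (lambdaWholeIndefinite_plain_gmCross hθ ht)

/-- **In-length class (row E-030), `K ≡ 1`, gm-cross `t·√𝔅(u)`:** the model CLOSES iff `1 < |t|` — at `t = 1` (the saturating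
world of record) it only TOUCHES zero (`lambdaBlockMainTerm_saturating_touch`). [cite: Zhang2022LandauSiegel, §7 Prop 7.1 (7.2)] -/
theorem eMultiLambdaCloses_sat_gmCross_iff (t : ℝ) :
    EMultiLambdaCloses saturatingDiag (gmCross t saturatingDiag) ↔ 1 < |t| := by
  constructor
  · intro h
    by_contra hle
    exact not_eMultiLambdaCloses_of_cs lambdaDiagNonneg_saturating
      (lambdaBlockCS_gmCross lambdaDiagNonneg_saturating (not_lt.1 hle)) h
  · intro ht
    exact eMultiLambdaCloses_iff_indefinite.2 (lambdaBlockIndefinite_sat_gmCross ht)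

/-! ### Part 4 — instance level: the verdict theorems applied in the named worlds to members of record -/

/-- `RepairGramBlock`'s `posSemidef_lambdaGram_of_slots` in the plain-diagonal world at ratio `1/2`, on the member
(`ϰ_{1,5/2}`, Feng's piece): the 2×2 model Gram block is PSD. [cite: Zhang2022LandauSiegel, §2 Lemma 2.3, (2.15)] -/
theorem posSemidef_lambdaGram_plain_half_feng1 :
    (lambdaGram (lambdaWholeDiag 1 fun z => z) (gmCross (1 / 2) (lambdaWholeDiag 1 fun z => z))
      (kappaP 1 (5 / 2)) (kappaP' 1 (5 / 2)) lambdaPieceFeng1).PosSemidef :=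
  posSemidef_lambdaGram_of_slots lambdaDiagNonneg_plain lambdaBlockCS_plain_half
    (kinkedProfile_kappaP one_pos le_rfl) (kappaP_one one_pos le_rfl) admissible_lambdaPieceFeng1

/-- `RepairLambdaBlock`'s `lambdaDiagNonneg_of_cs` in the plain world (its conclusion re-derived from the CS member).
[cite: Zhang2022LandauSiegel, §2 Lemma 2.3, (2.15)] -/
theorem lambdaDiagNonneg_of_cs_plain_half : LambdaDiagNonneg (lambdaWholeDiag 1 fun z => z) :=
  lambdaDiagNonneg_of_cs lambdaBlockCS_plain_half

/-- `RepairBlenLambda`'s `lambdaOverhangDiagNonneg_of_cs` in the plain-PNT world at ratio `1/2`.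
[cite: Zhang2022LandauSiegel, §2 Lemma 2.3, (2.15)] -/
theorem lambdaOverhangDiagNonneg_of_cs_plain_half (θ : ℝ) : LambdaOverhangDiagNonneg θ (lambdaOverhangDiag θ fun z => z) :=
  lambdaOverhangDiagNonneg_of_cs (lambdaOverhangCS_plain_half θ)

/-- `RepairBlenLambdaWhole`'s `lambdaWholeDiagNonneg_of_cs` in the plain-PNT world at ratio `1/2`.
[cite: Zhang2022LandauSiegel, §2 Lemma 2.3, (2.15)] -/
theorem lambdaWholeDiagNonneg_of_cs_plain_half (θ : ℝ) : LambdaWholeDiagNonneg θ (lambdaWholeDiag θ fun z => z) :=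
  lambdaWholeDiagNonneg_of_cs (lambdaWholeCS_plain_half θ)

/-- `KnifeEdge.LambdaWholeCS.overhang` in the plain-PNT world: the whole-range member restricts to an overhang member.
[cite: Zhang2022LandauSiegel, §2 Lemma 2.3, (2.15)] -/
theorem lambdaOverhangCS_of_whole_plain_half (θ : ℝ) :
    LambdaOverhangCS θ (lambdaWholeDiag θ fun z => z) (gmCross (1 / 2) (lambdaWholeDiag θ fun z => z)) :=
  (lambdaWholeCS_plain_half θ).overhang

/-- `RepairBlenLambda`'s `lambdaBlockMainTerm_lenLamGstarMV_of_cs` in the plain-PNT world at ratio `1/2`: on the kernel-mode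
member `g⋆ ⊕ c·MV_θ` the coupling VANISHES and the block value is `|c|²·K(MV_θ)`.
[cite: Zhang2022LandauSiegel, §7 Prop 7.1 (7.2)] -/
theorem lambdaBlockMainTerm_lenLamGstarMV_plain_half {θ : ℝ} (hθ : 1 < θ) (c : ℂ) :
    gmCross (1 / 2) (lambdaOverhangDiag θ fun z => z) gStar gStar' (mvTaperPiece θ) = 0 ∧
      lambdaBlockMainTerm (lambdaOverhangDiag θ fun z => z) (gmCross (1 / 2) (lambdaOverhangDiag θ fun z => z))
        gStar gStar' (mvTaperPiece θ) c = ‖c‖ ^ 2 * lambdaOverhangDiag θ (fun z => z) (mvTaperPiece θ) :=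
  lambdaBlockMainTerm_lenLamGstarMV_of_cs hθ (lambdaOverhangCS_plain_half θ) c

/-! ### Part 5 — `JumpKernelPos`: plain members and the M1 verdict in that world -/

/-- **The plain jump kernel `κ(z) = z`** — the `L²`-mass `‖𝟙_[0,z)‖² = z` of the balanced step, positive at every interior
height (plain-diagonal member; the DERIVED kernel of row multi-E1 is ls-theory's item, not this).
[cite: Zhang2022LandauSiegel, §10 Lemma 10.1 (10.5)] -/
theorem jumpKernelPos_id : JumpKernelPos fun z : ℝ => z := fun _ hz => hz.1

/-- A second member vanishing at BOTH ends, `κ(z) = z(1 − z) > 0` on `(0,1)`: the slot constrains interior heights only.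
[cite: Zhang2022LandauSiegel, §10 Lemma 10.1 (10.5)] -/
theorem jumpKernelPos_mul_one_sub : JumpKernelPos fun z : ℝ => z * (1 - z) :=
  fun _ hz => mul_pos hz.1 (by linarith [hz.2])

/-- `RepairJumpBlock`'s `familyJumpBlock_verdict_of_jumpKernelPos` in the plain-kernel world on the members of record
`jumpOne` (multi-jump-001) and `jumpStar` (`g⋆` + one balanced step). [cite: Zhang2022LandauSiegel, §7 Prop 7.1 (7.2); §10 (10.5)] -/
theorem familyJumpBlock_verdict_id_examples :
    0 ≤ jumpMainTerm (fun z : ℝ => z) jumpOne ∧ 0 ≤ jumpMainTerm (fun z : ℝ => z) jumpStar :=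
  ⟨familyJumpBlock_verdict_of_jumpKernelPos jumpKernelPos_id admissible_jumpOne,
    familyJumpBlock_verdict_of_jumpKernelPos jumpKernelPos_id admissible_jumpStar⟩

/-- … and the value on `jumpStar` is the kernel value `κ(1/2) = 1/2` (non-degenerate: the member is not a null design in
this world). [cite: Zhang2022LandauSiegel, §10 Lemma 10.1 (10.5)] -/
theorem jumpMainTerm_id_jumpStar : jumpMainTerm (fun z : ℝ => z) jumpStar = 1 / 2 := jumpMainTerm_jumpStar _

end Repair

end Literature.NumberTheory.LFunctions.Zhang2022
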